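import Literature.Probability.RandomPlanarGeometry.HexSAWBrickWallBridgeRatio
import Literature.Probability.RandomPlanarGeometry.HexSAWBrickWallKestenRelation
import Literature.Probability.RandomPlanarGeometry.SAWHalfSpaceRatioOneStep
import HarnessLib

/-!
# `b_{N+1}(ℍ)/b_N(ℍ) → √(2+√2)`: the one-step ratio of brick-wall bridges of the hexagonal lattice
# (Madras–Slade Theorem 7.3.4(d) on `ℍ`)

Topic `Literature/Probability/RandomPlanarGeometry` (brick-wall bridges of `ℍ` by LENGTH, height = coordinate `0`:
`HexBW.bridges`, `HexBW.bridgeCount` of `HexSAWBrickWallWalks.lean`; irreducible bridges `HexBW.irreducibleBridgeCount`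
and the renewal equation `HexBW.bridgeCount_eq_sum_Icc` of `HexSAWBrickWallRenewal.lean`; Kesten's relation
`HexBW.kestenRelation` of `HexSAWBrickWallKestenRelation.lean`; the two-step limit `HV.hexBridgeRatioTwo` of
`HexSAWBrickWallBridgeRatio.lean`; and the tree's model-free Lawler–Schramm–Werner lemma `LSWRatio.tendsto_ratio_succ`
of `SAWHalfSpaceRatioOneStep.lean`).

Sources: N. Madras, G. Slade, *The Self-Avoiding Walk* (1993), §7.1 eq. (7.1.3) (p. 230: "Kesten originally
applied his pattern theorem to prove … `lim b_{N+1}/b_N = μ`") and Theorem 7.3.4(d) (p. 248) with its proof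
(pp. 248–249: the two-step limit (7.3.13), the renewal equation (4.2.2), Kesten's relation (4.2.4) split into odd and
even parts, and the odd irreducible bridge `λ₁ = 1`); H. Kesten, J. Math. Phys. 4 (1963) 960–969, §4; G. F. Lawler,
O. Schramm, W. Werner, *On the scaling limit of planar self-avoiding walk* (2004), Appendix A, (A.1)–(A.3) (the same
renewal argument for half-space walks); H. Duminil-Copin, S. Smirnov, Ann. of Math. 175 (2012), Theorem 1
(`μ_ℍ = √(2+√2)`).  Status in print: the one-step bridge ratio is printed and proved for `ℤ^d` only (tree
`Zd.MadrasSlade1993_thm734d`; on `𝕋`: `SAWTriangularBridgeRatioLimit`); for `ℍ` no count-ratio statement for bridges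
is printed in any frame.  Kesten's relation is proved in print for `ℤ^d` (Kesten 1963 §4; M–S (4.2.2)–(4.2.4), pp. 90–91) and STATED for
the honeycomb lattice in the strip frame of Duminil-Copin–Smirnov — Beaton–Bousquet-Mélou–de Gier–Duminil-Copin–Guttmann
2014, Appendix, before Lemma 11: "Kesten's relation for irreducible bridges … can be easily adapted to the honeycomb
lattice. It gives `Σ_{γ∈iSAB} x_c^{|γ|} = 1`" (no written proof; used numerically by Alm–Parviainen 2004 and Jensen
2004 §2) — where the tree proves it as `HV.hasSum_stripIlim`; the present brick-wall coordinate-`0` frame (bridges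
along the always-present horizontal bonds, `λ₁(ℍ) = 1`) is the perpendicular, inequivalent direction; there Kesten's
relation is likewise stated without proof, for the "PP-bridges" of the rotated honeycomb lattice, by Beaton 2014
(Appendix, display before Lemma 16: "can be adapted to our lattice without difficulty"), and `HexBW.kestenRelation` is
its first written proof
[cite: BeatonBousquetMelouDeGierDuminilCopinGuttmann2014, Appendix (display before Lemma 11)]
[cite: Beaton2014RotatedHoneycomb, Appendix (display before Lemma 16)]
[cite: Jensen2004SAWLowerBounds, §2] [cite: AlmParviainen2004].
Here: M–S's printed proof of (d), step for step, packaged by `LSWRatio.tendsto_ratio_succ` — the brick-wall frame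
of the lane (bridges ALONG the always-present horizontal bonds; odd lengths occur, `λ₁(ℍ) = 1`).

## Main statements (namespace `Literature.Probability.RandomPlanarGeometry.SAW`)

* `hexBridgeRatioOne_of_kestenRelation (hK) : Tendsto (b_{N+1}(ℍ)/b_N(ℍ)) atTop (𝓝 √(2+√2))`;
* **`hexBridgeRatioOne`** — the same with NO hypotheses (`hK := HexBW.kestenRelation`);
* `hexBridgeRatioOne'` — the limit written as `hexConnectiveConstant`.
-/

noncomputable section

open Filter Topology Finset

namespace Literature.Probability.RandomPlanarGeometry.SAW

/-- **`b_{N+1}(ℍ)/b_N(ℍ) → √(2+√2)` from Kesten's relation** (`Σ_k λ_k(ℍ) μ_ℍ^{-k} = 1`): Madras–Slade's proof of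
Theorem 7.3.4(d) — the two-step limit `b_{N+2}/b_N → μ²` (`HV.hexBridgeRatioTwo`), the renewal equation (4.2.2) read as
the inequality `Σ_{j=1}^{n} λ_j b_{n−j} ≤ b_n` (`HexBW.bridgeCount_eq_sum_Icc`), the odd irreducible bridge `λ₁ > 0`
(`HexBW.irreducibleBridgeCount_one_pos`), and the odd/even split of Kesten's relation, packaged by the tree's model-free
`LSWRatio.tendsto_ratio_succ`.
[cite: MadrasSlade1993, §7.1 eq. (7.1.3) (p. 230) and Theorem 7.3.4(d) (p. 248), proof pp. 248–249 ((7.3.13), (7.3.14), (4.2.2), (4.2.4)); LawlerSchrammWerner2004SAW, Appendix A, (A.1)–(A.3); DuminilCopinSmirnov2012, Theorem 1] -/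
theorem hexBridgeRatioOne_of_kestenRelation
    (hK : HasSum (fun k => (HexBW.irreducibleBridgeCount k : ℝ) / hexConnectiveConstant ^ k) 1) :
    Tendsto (fun N : ℕ => (HexBW.bridgeCount (N + 1) : ℝ) / HexBW.bridgeCount N) atTop
      (𝓝 (Real.sqrt (2 + Real.sqrt 2))) := by
  have hμ := hexConnectiveConstant_eq_of_thm1 DuminilCopinSmirnov2012_thm1_holds
  have hμpos : 0 < hexConnectiveConstant := hexConnectiveConstant_pos
  have hμsq : hexConnectiveConstant ^ 2 = 2 + Real.sqrt 2 := by
    rw [hμ]; exact Real.sq_sqrt (by positivity)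
  have hu : ∀ n, (0 : ℝ) < HexBW.bridgeCount n := fun n => by
    exact_mod_cast HexBW.one_le_bridgeCount n
  have hA2 : Tendsto (fun n : ℕ => (HexBW.bridgeCount (n + 2) : ℝ) / HexBW.bridgeCount n) atTop
      (𝓝 (hexConnectiveConstant ^ 2)) := by
    rw [hμsq]; exact HV.hexBridgeRatioTwo
  have hren : ∀ n : ℕ, 1 ≤ n → ∑ j ∈ Icc 1 n, (HexBW.irreducibleBridgeCount j : ℝ) *
      HexBW.bridgeCount (n - j) ≤ HexBW.bridgeCount n := fun n hn => by
    rw [HexBW.bridgeCount_eq_sum_Icc hn]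
    push_cast
    exact le_rfl
  have h := LSWRatio.tendsto_ratio_succ (u := fun n => (HexBW.bridgeCount n : ℝ))
    (lam := fun j => (HexBW.irreducibleBridgeCount j : ℝ)) (β := hexConnectiveConstant) hμpos hu
    (fun j => Nat.cast_nonneg _) (by simp [HexBW.irreducibleBridgeCount_zero])
    (by exact_mod_cast HexBW.irreducibleBridgeCount_one_pos) hK hA2 hren
  rwa [hμ] at h

/-- **`b_{N+1}(ℍ)/b_N(ℍ) → √(2+√2)` — the one-step ratio of the brick-wall bridge counts of the hexagonal lattice
converges to the connective constant, with NO hypotheses** (Madras–Slade Theorem 7.3.4(d) / Kesten's (7.1.3) on `ℍ`: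
Kesten's relation `HexBW.kestenRelation`, the two-step limit `HV.hexBridgeRatioTwo`, the renewal equation, `λ₁(ℍ) = 1`).
Printed and proved for `ℤ^d` only; not in print for `ℍ`.
[cite: MadrasSlade1993, Theorem 7.3.4(d) (p. 248), proof pp. 248–249; Kesten1963SAW, §4; DuminilCopinSmirnov2012, Theorem 1] -/
theorem hexBridgeRatioOne :
    Tendsto (fun N : ℕ => (HexBW.bridgeCount (N + 1) : ℝ) / HexBW.bridgeCount N) atTop
      (𝓝 (Real.sqrt (2 + Real.sqrt 2))) :=
  hexBridgeRatioOne_of_kestenRelation HexBW.kestenRelation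

/-- The one-step bridge ratio in terms of the connective constant: `b_{N+1}(ℍ)/b_N(ℍ) → μ_ℍ`.
[cite: MadrasSlade1993, Theorem 7.3.4(d) (p. 248)] -/
theorem hexBridgeRatioOne' :
    Tendsto (fun N : ℕ => (HexBW.bridgeCount (N + 1) : ℝ) / HexBW.bridgeCount N) atTop
      (𝓝 hexConnectiveConstant) := by
  rw [hexConnectiveConstant_eq_of_thm1 DuminilCopinSmirnov2012_thm1_holds]
  exact hexBridgeRatioOne

end Literature.Probability.RandomPlanarGeometry.SAW
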